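import Summits.Ventures.PercRepro.C026C028Gluing

/-!
# C-028(c) on both parts gives C-028(c) on the gluing (p6, gen 15; mine-3 MINE3-GLUING §3)

The side events of `C026C028Gluing` are read on the side restrictions; their probabilities under `p`
are the probabilities of the corresponding events of the PART under the restricted weights
(`prob_sideRestrict_eq_restrict`, the measure change: `weight p ω` factors over the two sides,
`weight_eq_mul_sides_c028`).  Hence the `Φ`-form hypotheses of `C028At_of_gluing` are exactly ROW C-028(c) of
the two parts (`C028At_iff_phi` applied to the part), and **C-028(c) on both parts — at the restricted
weights, with `P(a|b|c) > 0` on each — gives C-028(c) on the gluing** (`C028At_of_parts`): the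
composition step of the forest-class theorem in its recursive form.
-/

namespace PercRepro

open Finset

section MeasureChange

variable {E : Type*} [Fintype E] [DecidableEq E]

/-- The split of a configuration into its two sides. -/
def c028SideSplit (side : E → Bool) (s : Bool) :
    Config E ≃ ((e : {e // side e = s}) → Bool) × ((e : {e // ¬ side e = s}) → Bool) :=
  Equiv.piEquivPiSubtypeProd (fun e => side e = s) (fun _ => Bool)

omit [DecidableEq E] in
/-- The weight factors over the two sides. -/
theorem weight_eq_mul_sides_c028 (p : E → ℝ) (side : E → Bool) (s : Bool) (ω : Config E) :
    weight p ω = weight (fun e : {e // side e = s} => p e.1) (sideRestrict ω side s) *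
      weight (fun e : {e // ¬ side e = s} => p e.1) ((c028SideSplit side s ω).2) := by
  unfold weight
  rw [← Fintype.prod_subtype_mul_prod_subtype (fun e => side e = s)
    (fun e => if ω e then p e else 1 - p e)]
  rfl

/-- **Measure change**: an event read on the side-`s` restriction has, under `p`, the probability of
the event itself under the restricted weights. -/
theorem prob_sideRestrict_eq_restrict (p : E → ℝ) (side : E → Bool) (s : Bool)
    (P : Config {e // side e = s} → Prop) :
    prob p {ω | P (sideRestrict ω side s)} =
      prob (fun e : {e // side e = s} => p e.1) {τ | P τ} := by
  classical
  set wS := weight (fun e : {e // side e = s} => p e.1) with hwS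
  set wT := weight (fun e : {e // ¬ side e = s} => p e.1) with hwT
  have hsumT : ∑ τ, wT τ = 1 := sum_weight _
  have hind : ∀ (X : Set (Config E)) (ω : Config E),
      X.indicator (weight p) ω = X.indicator (fun _ => (1 : ℝ)) ω * weight p ω := by
    intro X ω
    by_cases h : ω ∈ X <;> simp [Set.indicator, h]
  have hindS : ∀ (Y : Set (Config {e // side e = s})) (σ : Config {e // side e = s}),
      Y.indicator wS σ = Y.indicator (fun _ => (1 : ℝ)) σ * wS σ := by
    intro Y σ
    by_cases h : σ ∈ Y <;> simp [Set.indicator, h]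
  unfold prob
  have : ∑ σ, {τ | P τ}.indicator wS σ = (∑ σ, {τ | P τ}.indicator wS σ) * (∑ τ, wT τ) := by
    rw [hsumT, mul_one]
  rw [this, Finset.sum_mul_sum, ← Fintype.sum_prod_type', ← (c028SideSplit side s).sum_comp]
  refine Finset.sum_congr rfl fun ω _ => ?_
  rw [hind, hindS, weight_eq_mul_sides_c028 p side s ω]
  have hmem : (ω ∈ {ω | P (sideRestrict ω side s)}) ↔ ((c028SideSplit side s ω).1 ∈ {τ | P τ}) :=
    Iff.rfl
  by_cases h : ω ∈ {ω | P (sideRestrict ω side s)}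
  · rw [Set.indicator_of_mem h, Set.indicator_of_mem (hmem.1 h), mul_assoc]
    rfl
  · rw [Set.indicator_of_notMem h, Set.indicator_of_notMem (fun h' => h (hmem.2 h'))]
    simp

end MeasureChange

namespace MultiGraph

variable {V E : Type*} (G : MultiGraph V E) [Fintype E] [DecidableEq E]

/-- The side events are the part's events under the restricted weights. -/
theorem prob_sideIso (p : E → ℝ) (side : E → Bool) (s : Bool) (m x y : V) :
    prob p (G.c028SideIso side s m x y) =
      prob (fun e : {e // side e = s} => p e.1) {τ | (G.part side s).IsoMark τ m x y} :=
  prob_sideRestrict_eq_restrict p side s (fun τ => (G.part side s).IsoMark τ m x y)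

/-- The side all-separated event is the part's. -/
theorem prob_sideSepAll (p : E → ℝ) (side : E → Bool) (s : Bool) (a b c : V) :
    prob p (G.c028SideSepAll side s a b c) =
      prob (fun e : {e // side e = s} => p e.1)
        {τ | (G.part side s).IsoMark τ a b c ∧ (G.part side s).IsoMark τ b a c} :=
  prob_sideRestrict_eq_restrict p side s
    (fun τ => (G.part side s).IsoMark τ a b c ∧ (G.part side s).IsoMark τ b a c)

omit [Fintype E] [DecidableEq E] in
/-- The restricted weights are probabilities. -/
theorem isProb_sideRestrictWeights {p : E → ℝ} (hp : IsProb p) (side : E → Bool) (s : Bool) :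
    IsProb (fun e : {e // side e = s} => p e.1) :=
  fun e => hp e.1

/-- **C-028(c) on both parts gives C-028(c) on the gluing**: with `P(a|b|c) > 0` on each part at the
restricted weights. -/
theorem C028At_of_parts {a b c : V} {side : E → Bool} (hg : G.IsGluing a b c side) {p : E → ℝ}
    (hp : IsProb p)
    (hZT : 0 < (G.part side true).law3 (fun e => p e.1) a b c 4)
    (hZF : 0 < (G.part side false).law3 (fun e => p e.1) a b c 4)
    (hT : (G.part side true).C028At (fun e => p e.1) a b c)
    (hF : (G.part side false).C028At (fun e => p e.1) a b c) : G.C028At p a b c := by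
  have hpT := isProb_sideRestrictWeights hp side true
  have hpF := isProb_sideRestrictWeights hp side false
  rw [(G.part side true).C028At_iff_phi hpT hZT, law3_two_add_four_eq_isoMark,
    law3_three_add_four_eq_isoMark, law3_one_add_four_eq_isoMark, law3_four_eq_isoMark] at hT
  rw [(G.part side false).C028At_iff_phi hpF hZF, law3_two_add_four_eq_isoMark,
    law3_three_add_four_eq_isoMark, law3_one_add_four_eq_isoMark, law3_four_eq_isoMark] at hF
  rw [law3_four_eq_isoMark] at hZT hZF
  refine G.C028At_of_gluing hg hp ?_ ?_ ?_ ?_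
  · rw [G.prob_sideSepAll]; exact hZT
  · rw [G.prob_sideSepAll]; exact hZF
  · rw [G.prob_sideSepAll, G.prob_sideIso, G.prob_sideIso, G.prob_sideIso]; exact hT
  · rw [G.prob_sideSepAll, G.prob_sideIso, G.prob_sideIso, G.prob_sideIso]; exact hF

/-- **The degenerate case `Z = 0`**: when `P(a|b|c) = 0` the defect is `−K(Mₐ + M_b) ≤ 0` and C-028(c)
holds outright. -/
theorem C028At_of_law3_four_eq_zero {p : E → ℝ} (hp : IsProb p) {a b c : V}
    (h : G.law3 p a b c 4 = 0) : G.C028At p a b c := by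
  unfold C028At
  rw [G.c028Cov_eq_state, h]
  have h1 := prob_nonneg hp (G.partitionEvent ![a, b, c] ![0, 0, 1])
  have h2 := prob_nonneg hp (G.partitionEvent ![a, b, c] ![0, 1, 0])
  have h3 := prob_nonneg hp (G.partitionEvent ![a, b, c] ![0, 1, 1])
  rw [← law3_one] at h1
  rw [← law3_two] at h2
  rw [← law3_three] at h3
  have hs := Real.sqrt_nonneg (G.law3 p a b c 2 * G.law3 p a b c 3)
  nlinarith [mul_nonneg h1 (add_nonneg h2 h3)]

/-- **C-028(c) on both parts gives C-028(c) on the gluing**, no positivity needed: if `P(a|b|c)`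
vanishes on a part it vanishes on the gluing and C-028(c) is automatic. -/
theorem C028At_of_parts' {a b c : V} {side : E → Bool} (hg : G.IsGluing a b c side) {p : E → ℝ}
    (hp : IsProb p)
    (hT : (G.part side true).C028At (fun e => p e.1) a b c)
    (hF : (G.part side false).C028At (fun e => p e.1) a b c) : G.C028At p a b c := by
  have hpT := isProb_sideRestrictWeights hp side true
  have hpF := isProb_sideRestrictWeights hp side false
  have hZ := G.law3_four_gluing hg p
  rw [G.prob_sideSepAll, G.prob_sideSepAll, ← law3_four_eq_isoMark, ← law3_four_eq_isoMark] at hZ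
  rcases (prob_nonneg hpT ((G.part side true).partitionEvent ![a, b, c] ![0, 1, 2])).lt_or_eq
    with hZT | hZT
  · rcases (prob_nonneg hpF ((G.part side false).partitionEvent ![a, b, c] ![0, 1, 2])).lt_or_eq
      with hZF | hZF
    · rw [← law3_four] at hZT hZF
      exact G.C028At_of_parts hg hp hZT hZF hT hF
    · rw [← law3_four] at hZF
      refine G.C028At_of_law3_four_eq_zero hp ?_
      rw [hZ, ← hZF, mul_zero]
  · rw [← law3_four] at hZT
    refine G.C028At_of_law3_four_eq_zero hp ?_
    rw [hZ, ← hZT, zero_mul]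

end MultiGraph

end PercRepro
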